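import Mathlib
import Literature.MathematicalPhysics.QuantumFieldTheory.BalabanImbrieJaffe1984to88.BIJ85Eq7112FibreMinReal
import Literature.MathematicalPhysics.QuantumFieldTheory.BalabanImbrieJaffe1984to88.BIJ85Thm711Torus
import Literature.MathematicalPhysics.QuantumFieldTheory.BalabanImbrieJaffe1984to88.BIJ85Sigma712Torus

/-!
# `BalabanImbrieJaffe1984to88.BIJ85Eq7112SymbolFibreMin` — T. Bałaban, J. Imbrie, A. Jaffe, *Renormalization of the Higgs model:
minimizers, propagators and the stability of mean field theory*, Commun. Math. Phys. **97** (1985) 299–329 [BalabanImbrieJaffe1985]: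
Sect. 7.1 pp. 321–322 (7.1.2)/(7.1.12) over Sect. 4.2 p. 310 (4.2.1) — **THE MULTIPLICATION OPERATOR `σ_k(p)` OF THE σ_k OF RECORD IS THE
FIBRE MINIMUM OF THE EXPONENT OF (4.2.1)**: for the torus σ_k of (4.2.1)–(4.2.2) (seats p09/p30 `BIJ85Sigma421Torus.sigmaTorus`, the
`Setup` carriers of the series; physical weight `η^d`, `η = L^{−k}`, any curl normalisation `c ≠ 0`) and its momentum symbol `σ_k(p′) = symb
sigmaMatrix p′` (seat p33 `BIJ85Sigma712Torus`, the multiplication operator of (7.1.2)), **`⟨ψ, σ_k(p′)ψ⟩ = ½·m_{p′}(ψ^asym)` at EVERY dual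
momentum `p′` of `T₁^{(k)}`** (`m_{p′}` = file 1's `fibreMin (L^k) (Mk P k) p′`, the fibre minimum of the constrained exponent on the
`Tor` carriers of seats p27/p10; `½` = the ordered-pair convention of the `Tor` two-forms), together with **`⟨f, σ_kf⟩ = ½·Σ_{p′}
m_{p′}(f̂(p′))`** for every real unit-lattice plaquette field and **`star F ⬝ᵥ (sigmaMatrix *ᵥ F) = ½·inf_{Q_kA=0}‖∂^ηA − Q^{e*}_kF^asym‖²_η`**
for every complex one — file 3 of 4 of the (7.1.12) = (7.1.13) identification (file 4 `BIJ85Eq7113SymbolIdentification`: `½·m_{p′} = τ₁(p′)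
+ τ₂(p′)` at generic momenta with r15's symbols)

statement-level skeleton of published theorems with citation tags; proofs where landed; nothing here is a claim about
the Yang–Mills mass gap

PDF held: `paper:balaban1985-cmp97-bij-higgs-minimizers` (journal page = PDF page + 298).  Text read as images: PDF p. 12 (journal 310;
`run/shared/lean/pub/pub-balaban/t4/b2b-balaban-t4-lit2/renders/bij1985/1985-cmp97-bij-higgs-minimizers-p012-x2.png`), PDF pp. 23–24
(journal 321–322; `…-p023-x2.png`, `…-p024-x2.png`).

THE PRINTED TEXT (verbatim).  p. 321: *"The strategy of the proof is to give an explicit formula for σ_k, which we then analyze in detail.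
Since we study periodic boundary conditions, σ_k is translation invariant. Thus it is natural to study σ_k as a multiplication operator σ_k(p)
in the Fourier transform representation. … ⟨f^{(k)}, σ_kf^{(k)}⟩ = ∫⟨f̃(p), σ_k(p)f̃(p)⟩dp, (7.1.2)"*; p. 322: *"The basic object we wish to
study is σ_k, defined in (4.2.2), σ_k = Q^e_k(I − ∂G_{k,Ax}∂^*)Q^{e*}_k. (7.1.12) … Starting from this expression, one can derive the following
formulas for σ_k(p) by straightforward, algebraic manipulation"*; p. 310: *"exp(−½⟨f, σ_kf⟩) = Z_{k,Ax}^{−1}∫𝒟Aδ(Q_kA)δ_{k,Ax}(A)exp(−½‖∂A −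
Q^{e*}_kf‖²). (4.2.1) Here f is any real (Lie algebra) valued field defined on unit lattice plaquettes."*

CITATION HEADER (lean-in-tree rule).  Part of the lit-balaban TYPED SKELETON (HOME `run/shared/lean/pub/lit-balaban/`), Phase-2 seat p27
(gen 6), unit `lit-balaban-p27`; rows **C1.Eq7.1.2-7.1.12**, **C1.Eq7.1.13-7.1.19**, **C1.Thm7.1.1** of `HOME/SKELETON.md` (owner r15,
referee ref-5) — the identification member recorded NOT CLAIMED in `HOME/lit-balaban-r15/ROWS-C1.md` v1.35.  INPUTS (all landed, consumed by
name): p33 `BIJ85SigmaVariational.inner_sigmaTorus_le_energy`/`exists_energy_eq_inner_sigmaTorus` (`⟨f, σ_kf⟩ = inf_{Q_kA=0}‖∂A − Q^{e*}_kf‖²_η`,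
δ_{k,Ax} removed by gauge invariance), p33 `BIJ85Thm711TorusTransport` (`AC`, `fC`, `gC`, `asym`, `QvOp_AC_eq_zero_iff`) and
`BIJ85Thm711Torus.energy_transport` (the `Setup ↔ Tor (fine (L^k) Mk)` transport along p16's `EK`), p33 `BIJ85Sigma712Torus` (`cvec`,
`sigmaMatrix`, `form_sigmaMatrix`, `inner_sigmaTorus_comm`, `eq712_sigmaTorus`), p30 `BIJ85SigmaTorusScaling.sigmaTorus_indep_c`, gen 4's
`BIJ85Eq712Plancherel` (`dftC`, `symb`), files 1–2 (`fibreMin`, `energy421`, `iInf_energy421_eq_sum_fibreMin`, `iInf_energy421_eq_reP_add_imP`).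
WHAT IS KERNEL-CHECKED (zero `sorry`, standard axioms; bookkeeping defs `AR` (inverse transport of a real `Tor` field), `asymO` (one-point
antisymmetrisation), `mode` (single-momentum field) with bodies; no `def … : Prop`, no new named fact, D-0026): §1 `energy421_AC_fC` (the
`Setup` exponent of (4.2.1) is half the `Tor` one), `AC_AR`, **`two_mul_inner_sigmaTorus_le_energy421`**, `exists_energy421_eq_two_mul_inner`,
**`two_mul_inner_sigmaTorus_eq_iInf`**, **`inner_sigmaTorus_eq_half_sum_fibreMin`**; §2 `fC_eq_asym_cvec`, `reP_asym`/`imP_asym`,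
`dftC_mulVec_asym`, **`form_sigmaMatrix_complex`** (`star F ⬝ᵥ σF = ⟨Re F, σ Re F⟩ + ⟨Im F, σ Im F⟩`), **`form_sigmaMatrix_eq_half_iInf`**,
**`form_sigmaMatrix_eq_half_sum_fibreMin`**; §3 **`symb_sigmaMatrix_form_eq_half_fibreMin`** (`⟨ψ, σ_k(p′)ψ⟩ = ½·fibreMin (L^k) Mk p′ (asymO ψ)`,
weight `η^d`) and `symb_sigmaMatrix_form_eq_half_fibreMin_weight` (any weight `w > 0`: factor `w·L^{kd}`).  HONEST SCOPE: `L` is odd in `Setup`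
but nothing here uses it (every block size `n = L^k`); the closed form of `m_{p′}` ((7.1.13)–(7.1.16)) is file 4 / seat p10, not claimed here.
-/

namespace Literature.MathematicalPhysics.QuantumFieldTheory.BalabanImbrieJaffe1984to88.BIJ85Eq7112SymbolFibreMin

open scoped BigOperators RealInnerProductSpace Matrix ComplexConjugate
open Literature.MathematicalPhysics.QuantumFieldTheory.Balaban1983to89
open LatticeFieldCalculus (bondAvgIter)
open BIJ85Eq531Inputs (QestarIter)
open B5Prop11Plancherel (Tor fine dft)
open B5Block118 (QvOp)
open B5Eq117TorusCarriers (Mk EK)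
open BIJ85Eq715ConfigSymbols (curlC dftC_mulVec_apply)
open BIJ85Eq7111EdgeAdjoint (edgeAdjC)
open BIJ85Eq712Plancherel (dftC symb dftC_mul_star)
open BIJ85Sigma712Torus (Orient torN plaqEquiv plaqEquiv_symm_apply cvec cvec_apply sigmaMatrix form_sigmaMatrix inner_sigmaTorus_comm
  eq712_sigmaTorus)
open BIJ85Thm711TorusTransport (asym asym_apply_lt asym_apply_gt asym_apply_self AC fC gC sum_norm_sq_gC)
open BIJ85Thm711Torus (QvOp_AC_eq_zero_iff energy_transport eta_pow_d eta_pow_d_pos)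
open BIJ85AxialPropagator411 BIJ85SigmaForm421 BIJ85Sigma421Torus BIJ85SigmaVariational BIJ85SigmaTorusScaling
open BIJ85Eq7112FibreMin BIJ85Eq7112FibreMinReal

noncomputable section

variable {P : Params} {k : ℕ}

/-! ## §1 The form of the σ_k of record is half the `Tor` infimum, hence half the sum of the fibre minima -/

/-- kernel: `L^k ≠ 0` in `ℝ`. [folklore] -/
private theorem Lk_ne_zero (P : Params) (k : ℕ) : ((P.L : ℝ) ^ k) ≠ 0 := pow_ne_zero _ (Nat.cast_ne_zero.2 P.L_pos.ne')

/-- **The `Setup` exponent of (4.2.1) is half the `Tor` one**: `energy421 (L^k) Mk (AC A) (fC f) = 2·‖√η^d·∂_{L^k}A − √η^d·Q^{e*}_kf‖²` (the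
ordered-pair two-forms of the `Tor` carriers count every oriented plaquette twice; p33's `energy_transport` + `sum_norm_sq_gC` + `energy_eq_sum`).
[cite: BalabanImbrieJaffe1985, (4.2.1) p.310] -/
theorem energy421_AC_fC (hd : 2 ≤ P.d) (hk : k ≤ P.m + P.K) (A : VecField P 0 ℝ) (f : UnitPlaqSpace P k) :
    energy421 (P.L ^ k) (Mk P k) (AC hk A) (fC k fun q => f q)
      = 2 * ‖curlOp (P := P) (P.eta k ^ P.d) ((P.L : ℝ) ^ k) (toE P A) - QesOp (P := P) hd (P.eta k ^ P.d) k f‖ ^ 2 := by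
  rw [energy421_def, energy_transport hd hk, sum_norm_sq_gC hk, ← eta_pow_d, energy_eq_sum hd (eta_pow_d_pos P k).le _ k A f,
    Finset.mul_sum, Finset.mul_sum, Finset.mul_sum]
  refine Finset.sum_congr rfl fun p _ => ?_
  ring

/-- **The inverse transport**: the REAL η-bond field of `Setup` read off a (complex) field on `Tor (fine (L^k) Mk)` — `A(⟨x, μ⟩) = Re A′(EK x, μ)`.
[cite: Balaban1984PropagatorsI, (1.18) p.20] -/
def AR (hk : k ≤ P.m + P.K) (A' : Tor (fine (P.L ^ k) (Mk P k)) × Fin P.d → ℂ) : VecField P 0 ℝ :=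
  fun b => (A' (EK hk b.src, b.dir)).re

/-- `AC (AR A′) = Re A′`: transporting back gives the real part. [cite: Balaban1984PropagatorsI, (1.18) p.20] -/
theorem AC_AR (hk : k ≤ P.m + P.K) (A' : Tor (fine (P.L ^ k) (Mk P k)) × Fin P.d → ℂ) : AC hk (AR hk A') = reP A' := by
  funext i
  obtain ⟨z, μ⟩ := i
  simp [AC, AR]

/-- `fC f` is a real two-form: `Re (fC f) = fC f`. [cite: BalabanImbrieJaffe1985, (4.2.1) p.310] -/
theorem reP_fC (f : Plaq P k → ℝ) : reP (fC k f) = fC k f := by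
  funext i
  obtain ⟨x, μ, ν⟩ := i
  rw [reP_apply]
  rcases lt_trichotomy μ ν with h | rfl | h
  · rw [fC, asym_apply_lt _ _ h, Complex.ofReal_re]
  · rw [fC, asym_apply_self, Complex.zero_re, Complex.ofReal_zero]
  · rw [fC, asym_apply_gt _ _ h, Complex.neg_re, Complex.ofReal_re, Complex.ofReal_neg]

/-- **Every constrained COMPLEX η-field on the `Tor` carrier pays at least `2⟨f, σ_kf⟩` against a real unit field** (`σ_k = sigmaTorus hd (η^d)
(L^k) k`): `Q_kA′ = 0 ⟹ 2⟨f, σ_kf⟩ ≤ energy421 (L^k) Mk A′ (fC f)` — p33's `inner_sigmaTorus_le_energy` at the real part `AR A′` + file 2's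
`energy421_reP_le`. [cite: BalabanImbrieJaffe1985, (4.2.1) p.310] -/
theorem two_mul_inner_sigmaTorus_le_energy421 (hd : 2 ≤ P.d) (hk : k ≤ P.m + P.K) (f : UnitPlaqSpace P k)
    {A' : Tor (fine (P.L ^ k) (Mk P k)) × Fin P.d → ℂ} (hA' : QvOp (P.L ^ k) (Mk P k) *ᵥ A' = 0) :
    2 * ⟪f, sigmaTorus (P := P) hd (P.eta k ^ P.d) ((P.L : ℝ) ^ k) k f⟫ ≤ energy421 (P.L ^ k) (Mk P k) A' (fC k fun q => f q) := by
  have hre : QvOp (P.L ^ k) (Mk P k) *ᵥ reP A' = 0 := ((QvOp_eq_zero_iff_reP_imP _ _ A').1 hA').1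
  rw [← AC_AR hk] at hre
  have hQ : bondAvgIter k (AR hk A') = 0 := (QvOp_AC_eq_zero_iff hk _).1 hre
  have h1 := inner_sigmaTorus_le_energy hd hk (eta_pow_d_pos P k) (Lk_ne_zero P k) f (AR hk A') hQ
  have h2 := energy421_AC_fC hd hk (AR hk A') f
  have h3 := energy421_reP_le (P.L ^ k) (Mk P k) A' (reP_fC (k := k) fun q => f q)
  rw [AC_AR] at h2
  linarith

/-- **The bound is attained**: some constrained (indeed real, k-axial) η-field realises `energy421 A′ (fC f) = 2⟨f, σ_kf⟩` (p33's
`exists_energy_eq_inner_sigmaTorus`, transported). [cite: BalabanImbrieJaffe1985, (4.2.1) p.310] -/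
theorem exists_energy421_eq_two_mul_inner (hd : 2 ≤ P.d) (hk : k ≤ P.m + P.K) (f : UnitPlaqSpace P k) :
    ∃ A' : Tor (fine (P.L ^ k) (Mk P k)) × Fin P.d → ℂ, QvOp (P.L ^ k) (Mk P k) *ᵥ A' = 0 ∧
      energy421 (P.L ^ k) (Mk P k) A' (fC k fun q => f q) = 2 * ⟪f, sigmaTorus (P := P) hd (P.eta k ^ P.d) ((P.L : ℝ) ^ k) k f⟫ := by
  obtain ⟨A, hQ, -, hE⟩ := exists_energy_eq_inner_sigmaTorus hd hk (eta_pow_d_pos P k) (Lk_ne_zero P k) f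
  exact ⟨AC hk A, (QvOp_AC_eq_zero_iff hk A).2 hQ, by rw [energy421_AC_fC hd hk A f, hE]⟩

/-- **`2⟨f, σ_kf⟩ = inf_{Q_kA′=0} energy421 A′ (fC f)`** — the form of the σ_k of record IS the constrained infimum of the exponent of
(4.2.1) on the `Tor` carriers (any curl normalisation `c ≠ 0`, p30's `sigmaTorus_indep_c`). [cite: BalabanImbrieJaffe1985, (7.1.12) p.322] -/
theorem two_mul_inner_sigmaTorus_eq_iInf (hd : 2 ≤ P.d) (hk : k ≤ P.m + P.K) {c : ℝ} (hc : c ≠ 0) (f : UnitPlaqSpace P k) :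
    2 * ⟪f, sigmaTorus (P := P) hd (P.eta k ^ P.d) c k f⟫
      = ⨅ B : {A : Tor (fine (P.L ^ k) (Mk P k)) × Fin P.d → ℂ // QvOp (P.L ^ k) (Mk P k) *ᵥ A = 0},
          energy421 (P.L ^ k) (Mk P k) B.1 (fC k fun q => f q) := by
  haveI : Nonempty {A : Tor (fine (P.L ^ k) (Mk P k)) × Fin P.d → ℂ // QvOp (P.L ^ k) (Mk P k) *ᵥ A = 0} :=
    ⟨⟨0, Matrix.mulVec_zero _⟩⟩
  rw [sigmaTorus_indep_c hd hk (eta_pow_d_pos P k) hc (Lk_ne_zero P k)]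
  apply le_antisymm
  · exact le_ciInf fun B => two_mul_inner_sigmaTorus_le_energy421 hd hk f B.2
  · obtain ⟨A', hA', hE⟩ := exists_energy421_eq_two_mul_inner hd hk f
    exact (iInf_energy421_le _ _ hA' _).trans_eq hE

/-- **`⟨f, σ_kf⟩ = ½·Σ_{p′} m_{p′}(f̂(p′))`**: the form of the σ_k of record is half the sum over the dual momenta of `T₁^{(k)}` of the fibre minima
of the transform of `fC f` (file 1's `iInf_energy421_eq_sum_fibreMin`). [cite: BalabanImbrieJaffe1985, (7.1.2) p.321] -/
theorem inner_sigmaTorus_eq_half_sum_fibreMin (hd : 2 ≤ P.d) (hk : k ≤ P.m + P.K) {c : ℝ} (hc : c ≠ 0) (f : UnitPlaqSpace P k) :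
    ⟪f, sigmaTorus (P := P) hd (P.eta k ^ P.d) c k f⟫
      = (1 / 2 : ℝ) * ∑ q : Tor (Mk P k), fibreMin (P.L ^ k) (Mk P k) q
          (fun a => (dftC (Mk P k) (Fin P.d × Fin P.d) *ᵥ fC k fun q => f q) (q, a)) := by
  rw [← iInf_energy421_eq_sum_fibreMin, ← two_mul_inner_sigmaTorus_eq_iInf hd hk hc f]
  ring

/-! ## §2 Complex two-forms: `star F ⬝ᵥ (sigmaMatrix *ᵥ F)` is half the `Tor` infimum for `F^asym` -/

/-- A unit plaquette field of `Setup`, read as a `Tor` two-form, is the antisymmetrisation of p33's `cvec`: `fC f = asym (cvec f)`.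
[cite: BalabanImbrieJaffe1985, (7.1.2) p.321] -/
theorem fC_eq_asym_cvec (f : UnitPlaqSpace P k) : (fC k fun q => f q) = asym (cvec k f) := rfl

/-- `Re` commutes with antisymmetrisation. [cite: BalabanImbrieJaffe1985, (7.1.2) p.321] -/
theorem reP_asym {X : Type*} (F : X × Orient P → ℂ) : reP (asym F) = asym (reP F) := by
  funext i
  obtain ⟨x, μ, ν⟩ := i
  rw [reP_apply]
  rcases lt_trichotomy μ ν with h | rfl | h
  · rw [asym_apply_lt _ _ h, asym_apply_lt _ _ h, reP_apply]
  · rw [asym_apply_self, asym_apply_self, Complex.zero_re, Complex.ofReal_zero]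
  · rw [asym_apply_gt _ _ h, asym_apply_gt _ _ h, reP_apply, Complex.neg_re, Complex.ofReal_neg]

/-- `Im` commutes with antisymmetrisation. [cite: BalabanImbrieJaffe1985, (7.1.2) p.321] -/
theorem imP_asym {X : Type*} (F : X × Orient P → ℂ) : imP (asym F) = asym (imP F) := by
  funext i
  obtain ⟨x, μ, ν⟩ := i
  rw [imP_apply]
  rcases lt_trichotomy μ ν with h | rfl | h
  · rw [asym_apply_lt _ _ h, asym_apply_lt _ _ h, imP_apply]
  · rw [asym_apply_self, asym_apply_self, Complex.zero_im, Complex.ofReal_zero]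
  · rw [asym_apply_gt _ _ h, asym_apply_gt _ _ h, imP_apply, Complex.neg_im, Complex.ofReal_neg]

/-- The real unit field whose `cvec` is `Re F`. [cite: BalabanImbrieJaffe1985, (4.2.1) p.310] -/
def uRe (k : ℕ) (F : Tor (torN P k) × Orient P → ℂ) : UnitPlaqSpace P k := toU P k fun q => (F (plaqEquiv P k q)).re

/-- The real unit field whose `cvec` is `Im F`. [cite: BalabanImbrieJaffe1985, (4.2.1) p.310] -/
def uIm (k : ℕ) (F : Tor (torN P k) × Orient P → ℂ) : UnitPlaqSpace P k := toU P k fun q => (F (plaqEquiv P k q)).im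

/-- `cvec (uRe F) = Re F`. [cite: BalabanImbrieJaffe1985, (7.1.2) p.321] -/
theorem cvec_uRe (F : Tor (torN P k) × Orient P → ℂ) : cvec k (uRe k F) = reP F := by
  funext a
  rw [cvec_apply, reP_apply]
  show (((F (plaqEquiv P k ((plaqEquiv P k).symm a))).re : ℝ) : ℂ) = _
  rw [Equiv.apply_symm_apply]

/-- `cvec (uIm F) = Im F`. [cite: BalabanImbrieJaffe1985, (7.1.2) p.321] -/
theorem cvec_uIm (F : Tor (torN P k) × Orient P → ℂ) : cvec k (uIm k F) = imP F := by
  funext a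
  rw [cvec_apply, imP_apply]
  show (((F (plaqEquiv P k ((plaqEquiv P k).symm a))).im : ℝ) : ℂ) = _
  rw [Equiv.apply_symm_apply]

/-- **The complex form of σ_k splits**: for a complex field `F = Re F + i·Im F` on `Tor × Orient`,
`star F ⬝ᵥ (sigmaMatrix *ᵥ F) = ⟨u, σ_ku⟩ + ⟨v, σ_kv⟩` with `u, v` the real unit fields `Re F`, `Im F` (σ_k real symmetric: the cross terms
cancel by p33's `inner_sigmaTorus_comm`; standing range, `w > 0`, `c ≠ 0`). [cite: BalabanImbrieJaffe1985, (7.1.2) p.321] -/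
theorem form_sigmaMatrix_complex (hd : 2 ≤ P.d) (hk : k ≤ P.m + P.K) {w : ℝ} (hw : 0 < w) {c : ℝ} (hc : c ≠ 0)
    (F : Tor (torN P k) × Orient P → ℂ) :
    star F ⬝ᵥ (sigmaMatrix hd w c k *ᵥ F)
      = (((⟪uRe k F, sigmaTorus (P := P) hd w c k (uRe k F)⟫ + ⟪uIm k F, sigmaTorus (P := P) hd w c k (uIm k F)⟫ : ℝ)) : ℂ) := by
  have hF : F = cvec k (uRe k F) + Complex.I • cvec k (uIm k F) := by
    rw [cvec_uRe, cvec_uIm, reP_add_I_smul_imP]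
  have hcross : star (cvec k (uRe k F)) ⬝ᵥ (sigmaMatrix hd w c k *ᵥ cvec k (uIm k F))
      = star (cvec k (uIm k F)) ⬝ᵥ (sigmaMatrix hd w c k *ᵥ cvec k (uRe k F)) := by
    rw [form_sigmaMatrix, form_sigmaMatrix, ← inner_sigmaTorus_comm hd hk hw hc, real_inner_comm]
  conv_lhs => rw [hF]
  rw [Matrix.mulVec_add, Matrix.mulVec_smul, star_add, star_smul, add_dotProduct, dotProduct_add, dotProduct_add, smul_dotProduct,
    smul_dotProduct, dotProduct_smul, dotProduct_smul, hcross, form_sigmaMatrix hd w c k (uRe k F) (uRe k F),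
    form_sigmaMatrix hd w c k (uIm k F) (uRe k F), form_sigmaMatrix hd w c k (uIm k F) (uIm k F), Complex.star_def, Complex.conj_I]
  simp only [smul_eq_mul]
  push_cast
  linear_combination (-(⟪uIm k F, sigmaTorus (P := P) hd w c k (uIm k F)⟫ : ℂ)) * Complex.I_mul_I

/-- **`star F ⬝ᵥ (sigmaMatrix *ᵥ F) = ½·inf_{Q_kA=0} energy421 A F^asym`** for every COMPLEX field `F` on `Tor (Mk P k) × Orient` (weight `η^d`,
any `c ≠ 0`): §1 for `Re F` and `Im F` + file 2's real/imaginary splitting of the infimum. [cite: BalabanImbrieJaffe1985, (7.1.12) p.322] -/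
theorem form_sigmaMatrix_eq_half_iInf (hd : 2 ≤ P.d) (hk : k ≤ P.m + P.K) {c : ℝ} (hc : c ≠ 0) (F : Tor (torN P k) × Orient P → ℂ) :
    star F ⬝ᵥ (sigmaMatrix hd (P.eta k ^ P.d) c k *ᵥ F)
      = ((((1 / 2 : ℝ) * ⨅ B : {A : Tor (fine (P.L ^ k) (Mk P k)) × Fin P.d → ℂ // QvOp (P.L ^ k) (Mk P k) *ᵥ A = 0},
          energy421 (P.L ^ k) (Mk P k) B.1 (asym F) : ℝ)) : ℂ) := by
  rw [form_sigmaMatrix_complex hd hk (eta_pow_d_pos P k) hc, iInf_energy421_eq_reP_add_imP, reP_asym, imP_asym, ← cvec_uRe, ← cvec_uIm,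
    ← fC_eq_asym_cvec, ← fC_eq_asym_cvec, ← two_mul_inner_sigmaTorus_eq_iInf hd hk hc, ← two_mul_inner_sigmaTorus_eq_iInf hd hk hc]
  push_cast
  ring

/-- `F⊗1` acts on the position variable only: it commutes with antisymmetrisation of the components. [cite: BalabanImbrieJaffe1985, (7.1.2) p.321] -/
theorem dftC_mulVec_asym {N : Fin P.d → ℕ} [∀ μ, NeZero (N μ)] (F : Tor N × Orient P → ℂ) :
    dftC N (Fin P.d × Fin P.d) *ᵥ asym F = asym (dftC N (Orient P) *ᵥ F) := by
  funext i
  obtain ⟨p, μ, ν⟩ := i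
  rw [dftC_mulVec_apply]
  rcases lt_trichotomy μ ν with h | rfl | h
  · rw [asym_apply_lt _ _ h, dftC_mulVec_apply]
    exact Finset.sum_congr rfl fun x _ => by rw [asym_apply_lt _ _ h]
  · rw [asym_apply_self]
    exact Finset.sum_eq_zero fun x _ => by rw [asym_apply_self, mul_zero]
  · rw [asym_apply_gt _ _ h, dftC_mulVec_apply, ← Finset.sum_neg_distrib]
    exact Finset.sum_congr rfl fun x _ => by rw [asym_apply_gt _ _ h, mul_neg]

/-- **`star F ⬝ᵥ (sigmaMatrix *ᵥ F) = ½·Σ_{p′} m_{p′}((F̂(p′))^asym)`** for every complex `F` (weight `η^d`, any `c ≠ 0`): (7.1.2) for the σ_k of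
record with the fibre form IDENTIFIED as the fibre minimum. [cite: BalabanImbrieJaffe1985, (7.1.2) p.321] -/
theorem form_sigmaMatrix_eq_half_sum_fibreMin (hd : 2 ≤ P.d) (hk : k ≤ P.m + P.K) {c : ℝ} (hc : c ≠ 0)
    (F : Tor (torN P k) × Orient P → ℂ) :
    star F ⬝ᵥ (sigmaMatrix hd (P.eta k ^ P.d) c k *ᵥ F)
      = ((((1 / 2 : ℝ) * ∑ q : Tor (Mk P k), fibreMin (P.L ^ k) (Mk P k) q
          (fun a => asym (dftC (Mk P k) (Orient P) *ᵥ F) (q, a)) : ℝ)) : ℂ) := by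
  rw [form_sigmaMatrix_eq_half_iInf hd hk hc, iInf_energy421_eq_sum_fibreMin, dftC_mulVec_asym]

/-! ## §3 `σ_k(p′)` fibre by fibre: single-momentum test fields -/

/-- **One-point antisymmetrisation**: the ordered-pair components of a fibre vector `ψ` on the orientations `μ < ν`. [cite: BalabanImbrieJaffe1985, (7.1.3) p.321] -/
def asymO (ψ : Orient P → ℂ) : Fin P.d × Fin P.d → ℂ := fun a =>
  if h : a.1 < a.2 then ψ ⟨a, h⟩ else if h' : a.2 < a.1 then -ψ ⟨(a.2, a.1), h'⟩ else 0

/-- `asym F (x, ·) = asymO (F (x, ·))`. [cite: BalabanImbrieJaffe1985, (7.1.3) p.321] -/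
theorem asym_apply_eq_asymO {X : Type*} (F : X × Orient P → ℂ) (x : X) (a : Fin P.d × Fin P.d) :
    asym F (x, a) = asymO (fun o => F (x, o)) a := rfl

/-- `asymO 0 = 0`. [cite: BalabanImbrieJaffe1985, (7.1.3) p.321] -/
theorem asymO_zero : asymO (P := P) (fun _ => 0) = 0 := by
  funext a
  simp [asymO]

/-- The momentum-space field with the single mode `p′` and fibre vector `ψ`: `δ_{p′} ⊗ ψ`. [cite: BalabanImbrieJaffe1985, (7.1.22) p.324] -/
def mode {N : Fin P.d → ℕ} (p : Tor N) (ψ : Orient P → ℂ) : Tor N × Orient P → ℂ := fun a => if a.1 = p then ψ a.2 else 0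

/-- kernel: `(F⊗1)((F⊗1)^* e) = e`. [folklore] -/
private theorem dftC_mulVec_star_mulVec {N : Fin P.d → ℕ} [∀ μ, NeZero (N μ)] (e : Tor N × Orient P → ℂ) :
    dftC N (Orient P) *ᵥ (star (dftC N (Orient P)) *ᵥ e) = e := by
  rw [Matrix.mulVec_mulVec, dftC_mul_star, Matrix.one_mulVec]

/-- **THE MULTIPLICATION OPERATOR `σ_k(p′)` IS HALF THE FIBRE MINIMUM**: for the σ_k of record in the physical normalisation (weight `η^d`,
`η = L^{−k}`, any curl factor `c ≠ 0`, standing range `k ≤ m + K`, `2 ≤ d`), at EVERY dual momentum `p′` of `T₁^{(k)}` and for every fibre vector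
`ψ`: `⟨ψ, σ_k(p′)ψ⟩ = ½·fibreMin (L^k) (Mk P k) p′ (asymO ψ)` — the symbol of p33's `sigmaMatrix` tested on the field `(F⊗1)^*(δ_{p′} ⊗ ψ)`.
[cite: BalabanImbrieJaffe1985, (7.1.12) p.322] -/
theorem symb_sigmaMatrix_form_eq_half_fibreMin (hd : 2 ≤ P.d) (hk : k ≤ P.m + P.K) {c : ℝ} (hc : c ≠ 0)
    (p : Tor (torN P k)) (ψ : Orient P → ℂ) :
    star ψ ⬝ᵥ (symb (torN P k) (Orient P) (sigmaMatrix hd (P.eta k ^ P.d) c k) p *ᵥ ψ)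
      = ((((1 / 2 : ℝ) * fibreMin (P.L ^ k) (Mk P k) p (asymO ψ) : ℝ)) : ℂ) := by
  classical
  set F : Tor (torN P k) × Orient P → ℂ := star (dftC (torN P k) (Orient P)) *ᵥ mode p ψ with hFdef
  have hhat : dftC (torN P k) (Orient P) *ᵥ F = mode p ψ := dftC_mulVec_star_mulVec _
  -- left: (7.1.2) for `F` collapses to the fibre `p`
  have hL : star F ⬝ᵥ (sigmaMatrix hd (P.eta k ^ P.d) c k *ᵥ F)
      = star ψ ⬝ᵥ (symb (torN P k) (Orient P) (sigmaMatrix hd (P.eta k ^ P.d) c k) p *ᵥ ψ) := by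
    rw [eq712_sigmaTorus hd hk (eta_pow_d_pos P k) hc, hhat, Finset.sum_eq_single p]
    · have h1 : (fun i => mode p ψ (p, i)) = ψ := funext fun i => if_pos rfl
      rw [h1]
    · intro q _ hq
      have h0 : (fun i => mode p ψ (q, i)) = 0 := funext fun i => if_neg hq
      rw [h0, Matrix.mulVec_zero, dotProduct_zero]
    · exact fun h => absurd (Finset.mem_univ p) h
  -- right: the fibre minima of `(mode p ψ)^asym` vanish off `p`
  have hR : ∑ q : Tor (Mk P k), fibreMin (P.L ^ k) (Mk P k) q (fun a => asym (dftC (Mk P k) (Orient P) *ᵥ F) (q, a))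
      = fibreMin (P.L ^ k) (Mk P k) p (asymO ψ) := by
    rw [show (dftC (Mk P k) (Orient P) *ᵥ F) = mode p ψ from hhat, Finset.sum_eq_single p]
    · congr 1
      funext a
      rw [asym_apply_eq_asymO]
      have hm : (fun o => mode p ψ (p, o)) = ψ := funext fun o => if_pos rfl
      rw [hm]
    · intro q _ hq
      have h0 : (fun a => asym (mode p ψ) (q, a)) = 0 := by
        funext a
        rw [asym_apply_eq_asymO, Pi.zero_apply]
        have hm : (fun o => mode p ψ (q, o)) = fun _ => 0 := funext fun o => if_neg hq
        rw [hm, asymO_zero, Pi.zero_apply]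
      rw [h0, fibreMin_zero]
    · exact fun h => absurd (Finset.mem_univ p) h
  rw [← hL, form_sigmaMatrix_eq_half_sum_fibreMin hd hk hc, hR]

/-- The same at an ARBITRARY weight `w > 0`: `⟨ψ, σ_k^{(w)}(p′)ψ⟩ = ½·w·L^{kd}·fibreMin (L^k) (Mk P k) p′ (asymO ψ)` (σ_k is linear in the
weight, p30's `inner_sigmaTorus_scale_w`; `w = (w·L^{kd})·η^d`). [cite: BalabanImbrieJaffe1985, (7.1.12) p.322] -/
theorem symb_sigmaMatrix_form_eq_half_fibreMin_weight (hd : 2 ≤ P.d) (hk : k ≤ P.m + P.K) {w : ℝ} (hw : 0 < w) {c : ℝ} (hc : c ≠ 0)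
    (p : Tor (torN P k)) (ψ : Orient P → ℂ) :
    star ψ ⬝ᵥ (symb (torN P k) (Orient P) (sigmaMatrix hd w c k) p *ᵥ ψ)
      = ((((1 / 2 : ℝ) * (w * (((P.L ^ k : ℕ) : ℝ)) ^ P.d) * fibreMin (P.L ^ k) (Mk P k) p (asymO ψ) : ℝ)) : ℂ) := by
  have hη := eta_pow_d_pos P k
  have hLd : (0 : ℝ) < (((P.L ^ k : ℕ) : ℝ)) ^ P.d := by
    have : (0 : ℝ) < ((P.L ^ k : ℕ) : ℝ) := by exact_mod_cast pow_pos P.L_pos k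
    positivity
  have ha : 0 < w * (((P.L ^ k : ℕ) : ℝ)) ^ P.d := mul_pos hw hLd
  have hw' : w = w * (((P.L ^ k : ℕ) : ℝ)) ^ P.d * P.eta k ^ P.d := by
    rw [eta_pow_d, mul_assoc, mul_inv_cancel₀ hLd.ne', mul_one]
  -- the symbol is linear in the operator, and `sigmaMatrix hd w = (w·L^{kd}) • sigmaMatrix hd η^d` entrywise
  have hmat : sigmaMatrix hd w c k = (((w * (((P.L ^ k : ℕ) : ℝ)) ^ P.d : ℝ)) : ℂ) • sigmaMatrix hd (P.eta k ^ P.d) c k := by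
    ext a b
    rw [Matrix.smul_apply, BIJ85Sigma712Torus.sigmaMatrix_apply, BIJ85Sigma712Torus.sigmaMatrix_apply, smul_eq_mul]
    conv_lhs => rw [hw']
    rw [inner_sigmaTorus_scale_w hd hk ha hη hc hc]
    push_cast
    ring
  have hsymb : symb (torN P k) (Orient P) (sigmaMatrix hd w c k) p
      = (((w * (((P.L ^ k : ℕ) : ℝ)) ^ P.d : ℝ)) : ℂ) • symb (torN P k) (Orient P) (sigmaMatrix hd (P.eta k ^ P.d) c k) p := by
    ext i j
    rw [BIJ85Eq712Plancherel.symb_apply, Matrix.smul_apply, BIJ85Eq712Plancherel.symb_apply, smul_eq_mul, Finset.mul_sum]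
    refine Finset.sum_congr rfl fun z _ => ?_
    rw [hmat, Matrix.smul_apply, smul_eq_mul, mul_assoc]
  rw [hsymb, Matrix.smul_mulVec, dotProduct_smul, symb_sigmaMatrix_form_eq_half_fibreMin hd hk hc, smul_eq_mul]
  push_cast
  ring

end

end Literature.MathematicalPhysics.QuantumFieldTheory.BalabanImbrieJaffe1984to88.BIJ85Eq7112SymbolFibreMin
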